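import Summits.CriticalPhenomena.PercolationContinuityZ3.Theorems.Transplant.PlanarSkeletonFrmScaledCoarseMulti
import Summits.CriticalPhenomena.PercolationContinuityZ3.Theorems.Transplant.PlanarSkeletonFrmScaledRays
import Summits.CriticalPhenomena.PercolationContinuityZ3.Theorems.Transplant.SkelFrmFromProxHoldsAll
import HarnessLib

/-!
# THE ALIGNED MULTI-TYPE SCALED NODE (design owner's NEXT-SCOPE (N1)+(N2), p3-g27 2026-08-27; GEN pen gen-1 g3): **`θ_v(p_c) = 0` at EVERY vertex of every
# locally finite graph carrying a `PlanarSkeletonFrmScaled` with ANY NUMBER OF TYPES, `L ≤ N`, and CHART-ALIGNED types** — the multi-type coarse skeleton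
# («PlanarSkeletonFrmScaledCoarseMulti» §2–§3) with its base-type proxies under alignment (§4) fed into the GEN node with proxies «SkelFrmFromProxHoldsAll» p486426

builds on p205010 (kernel theorem, internal audit signed; external expert review pending).  Lane `prim-bschramm`, seat `prim-bschramm-gen-1` g3 (GEN pen,
p3-lineage brief); helper file (`--supports stmt-CriticalPhenomena-4575 --as helper`); PROOFS ONLY, def-free — the alignment hypothesis is spelled out:
`∀ s ∈ Φ.types, ∀ s' ∈ Φ.types, ∃ α : G ≃g G, ∀ w, Φ.φ (α w) = Φ.φ w + (Φ.φ s − Φ.φ s')` (every difference of base chart values is the translation vector of a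
chart-translating automorphism; ONE TYPE ⇒ aligned with `α := 1`, so the U_s node's rider form `L ≤ N` is the one-type case — U_s itself, rider-free, is the landed
p483212 and is NOT restated).  Nothing here edits or declares a `@[conjecture]`; nothing is claimed about non-aligned multi-type skeletons, `L > N`, chartless
classes, the end state or Conj. 4 in general.
WHY IT IS A COMPOSITION: the four GEN column tops and «PlanarSkeletonFrmFrom1Px» §2 are carrier-generic (any `PlanarSkeletonFrmFrom`, any number of types, at a
type with `HasProxies t D`), whence p486426 `frmFromProx_criticalContinuity_holds`; the coarse chart `⌊φ/N⌋` of a scaled skeleton with `L ≤ N` is such a carrier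
with NO one-type hypothesis (`coarse_lip`, `steps_coarse`, `exists_coarseTypesAt v` — residue types containing any prescribed vertex `v` —, `coarse_cylConnFrom'`),
and under alignment `exists_proxies_of_aligned` supplies `HasProxies v D(Φ)` at every vertex `v`; Φ2 at `p_c` is automatic («SkelFrmFrom1SkeletonOnly»).
* `frmScaledAligned_criticalContinuity_holds (Φ) (hLN : Φ.L ≤ Φ.N) (hal : aligned) (v : V) : theta G v (criticalProbIOf G v) = 0`;
* `frmScaledAligned_drop_holds` — the same-`p` drop at every vertex and every density with `θ_v(p) > 0` (percolation plumbing «PlanarSkeletonFrmFrom1Px» §1);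
* `frmScaledAligned_criticalContinuity_holds_at` — the single-base form of the hypothesis (types aligned with ONE vertex `t`) at the vertex `t`.
[cite: BenjaminiSchramm1996, Conj. 4; §2 (almost transitive graphs)] [cite: KozmaNitzan2024, §1 p. 2 (approach 1); §4 p. 16 (Lemma 8), pp. 19–21, Theorem 6]
[cite: Hutchcroft2016, Thm. 1] [cite: LyonsPeres2016, Thm. 7.6] [cite: AizenmanGrimmett1991, Thm 1 (essential enhancements)] [this work]
-/

noncomputable section

namespace Summit.CriticalPhenomena.PercolationContinuityZ3.Theorems

namespace Transplant

open MeasureTheory Literature.Probability.Percolation Literature.Probability.LatticeModels SimpleGraph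
open Literature.Barriers.CriticalPhenomena (graphBall countable_of_connected_of_locallyFinite)
open scoped Classical

/-- **THE ALIGNED MULTI-TYPE SCALED NODE, single-base form**: on a locally finite graph `G` carrying a `PlanarSkeletonFrmScaled Φ` (ANY number of base-vertex types;
`L`-Lipschitz chart, translating frames, exact single-edge `N`-steps, cylinders connected from some width on) with `Φ.L ≤ Φ.N`, every vertex `t` with which all
types are CHART-ALIGNED (`∀ s ∈ Φ.types, ∃ α : G ≃g G, φ ∘ α = φ + (φ s − φ t)`) has `θ_t(p_c(G,t)) = 0`.  Proof: the coarse chart `⌊φ/N⌋` with the residue types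
`T ∋ t` of `exists_coarseTypesAt` is a multi-type `PlanarSkeletonFrmFrom` (1-Lipschitz by `L ≤ N`, unit steps, exact coarse frames, coarse cylinders connected from
`max ℓ₀ 1`), it has proxies of type `t` at the radius of `exists_proxies_of_aligned` (connectedness from the skeleton), and p486426
`frmFromProx_criticalContinuity_holds` applies on the SAME graph at the SAME vertex.
builds on p205010 (kernel theorem, internal audit signed; external expert review pending). [cite: BenjaminiSchramm1996, Conj. 4] [cite: KozmaNitzan2024, §4] -/
theorem frmScaledAligned_criticalContinuity_holds_at {V : Type} (G : SimpleGraph V) [G.LocallyFinite] (Φ : PlanarSkeletonFrmScaled G) (hLN : Φ.L ≤ Φ.N)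
    (t : V) (hal : ∀ s ∈ Φ.types, ∃ α : G ≃g G, ∀ w, Φ.φ (α w) = Φ.φ w + (Φ.φ s - Φ.φ t)) :
    theta G t (criticalProbIOf G t) = 0 := by
  obtain ⟨t₀, ht₀, -⟩ := Φ.frame t
  have hc : G.Connected := Φ.graph_connected ht₀
  obtain ⟨T, htT, -, hfr⟩ := Φ.exists_coarseTypesAt t
  obtain ⟨D, hD⟩ := Φ.exists_proxies_of_aligned hc t hal
  have hP : PlanarSkeletonFrmFrom.HasProxies
      (⟨Φ.coarse, Φ.coarse_lip hLN, T, hfr, Φ.Δ, Φ.degree_le, Φ.steps_coarse, max Φ.ℓ₀ 1, Φ.coarse_cylConnFrom' T⟩ : PlanarSkeletonFrmFrom G) t D := by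
    intro c
    obtain ⟨c', α, hαt, -, -, hcoarse, hcell, hcD, -⟩ := hD c
    exact ⟨c', α, hαt, hcoarse, hcell, hcD⟩
  exact frmFromProx_criticalContinuity_holds G _ htT hP

/-- **THE ALIGNED MULTI-TYPE SCALED NODE — `θ_v(p_c(G,v)) = 0` AT EVERY VERTEX**: on a locally finite graph carrying a `PlanarSkeletonFrmScaled` with any number
of types, `L ≤ N`, and PAIRWISE CHART-ALIGNED types (`∀ s s' ∈ Φ.types, ∃ α : G ≃g G, φ ∘ α = φ + (φ s − φ s')`), Bernoulli bond percolation has no infinite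
cluster at criticality at every vertex.  (Pairwise-aligned types are aligned with every vertex, «PlanarSkeletonFrmScaledCoarseMulti» `aligned_of_pairwise`; one
type is the U_s node's rider form.)  Nothing else is assumed: connectedness, countability, quasi-transitivity, `p_c < 1`, uniqueness and Φ2 at `p_c` all come from
the skeleton through the landed chain.
builds on p205010 (kernel theorem, internal audit signed; external expert review pending). [cite: BenjaminiSchramm1996, Conj. 4; §2] [cite: KozmaNitzan2024, §4] -/
theorem frmScaledAligned_criticalContinuity_holds {V : Type} (G : SimpleGraph V) [G.LocallyFinite] (Φ : PlanarSkeletonFrmScaled G) (hLN : Φ.L ≤ Φ.N)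
    (hal : ∀ s ∈ Φ.types, ∀ s' ∈ Φ.types, ∃ α : G ≃g G, ∀ w, Φ.φ (α w) = Φ.φ w + (Φ.φ s - Φ.φ s')) (v : V) :
    theta G v (criticalProbIOf G v) = 0 :=
  frmScaledAligned_criticalContinuity_holds_at G Φ hLN v (Φ.aligned_of_pairwise hal v)

/-- **The same-`p` drop at every vertex of an aligned multi-type scaled skeleton with `L ≤ N`**: every density `p` with `θ_v(p) > 0` admits `q < p` with
`θ_v(q) > 0` — no uniqueness, Φ2 or `p < 1` hypothesis (`θ_v(p_c) = 0` and «PlanarSkeletonFrmFrom1Px» `drop_at_of_critical`).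
builds on p205010 (kernel theorem, internal audit signed; external expert review pending). [cite: BenjaminiSchramm1996, Conj. 4] [cite: KozmaNitzan2024, §1 p. 2] -/
theorem frmScaledAligned_drop_holds {V : Type} (G : SimpleGraph V) [G.LocallyFinite] (Φ : PlanarSkeletonFrmScaled G) (hLN : Φ.L ≤ Φ.N)
    (hal : ∀ s ∈ Φ.types, ∀ s' ∈ Φ.types, ∃ α : G ≃g G, ∀ w, Φ.φ (α w) = Φ.φ w + (Φ.φ s - Φ.φ s')) (v : V) (p : unitInterval)
    (hθ : 0 < theta G v p) : ∃ q : unitInterval, (q : ℝ) < p ∧ 0 < theta G v q := by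
  obtain ⟨t₀, ht₀, -⟩ := Φ.frame v
  haveI : Countable V := countable_of_connected_of_locallyFinite G (Φ.graph_connected ht₀) v
  exact drop_at_of_critical G v (P := fun _ => True) (fun _ => frmScaledAligned_criticalContinuity_holds G Φ hLN hal v) p trivial hθ

/-! ## §2 The From carrier (`L = N = 1`): aligned types, any number of them — proxies and `θ_v(p_c) = 0` from translation vectors alone -/

namespace PlanarSkeletonFrmFrom

variable {V : Type} {G : SimpleGraph V} [G.LocallyFinite]

/-- The coarse chart of `toFrmScaled` (`N = 1`) is the chart itself. [folklore] -/
theorem toFrmScaled_coarse (Φ : PlanarSkeletonFrmFrom G) (v : V) : Φ.toFrmScaled.coarse v = Φ.φ v :=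
  funext fun i => by rw [PlanarSkeletonFrmScaled.coarse_apply]; exact Int.ediv_one _

/-- **PROXIES FROM TRANSLATION VECTORS ALONE (From carrier, any number of types)**: if every base chart value `φ s` differs from `φ t` by the translation
vector of SOME chart-translating automorphism (`∀ s ∈ Φ.types, ∃ α : G ≃g G, φ ∘ α = φ + (φ s − φ t)` — no requirement `α t = s`, no distance datum), then
`Φ.HasProxies t D` for some radius `D` — «PlanarSkeletonFrmScaledCoarseMulti» `exists_proxies_of_aligned` read through `toFrmScaled` (`N = 1`: the coarse chart is
`φ`).  Weaker hypothesis than `HasProxies.of_aligned` (p486426 §2), same conclusion up to the radius. [this work] -/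
theorem exists_hasProxies_of_aligned (Φ : PlanarSkeletonFrmFrom G) (t : V)
    (hal : ∀ s ∈ Φ.types, ∃ α : G ≃g G, ∀ w, Φ.φ (α w) = Φ.φ w + (Φ.φ s - Φ.φ t)) : ∃ D : ℕ, Φ.HasProxies t D := by
  obtain ⟨D, hD⟩ := Φ.toFrmScaled.exists_proxies_of_aligned (Φ.graph_connected t) t hal
  refine ⟨D, fun c => ?_⟩
  obtain ⟨c', α, hαt, hφ, -, -, hcell, hcD, -⟩ := hD c
  refine ⟨c', α, hαt, hφ, ?_, hcD⟩
  rw [← Φ.toFrmScaled_coarse c', ← Φ.toFrmScaled_coarse c]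
  exact hcell

end PlanarSkeletonFrmFrom

/-- **THE ALIGNED MULTI-TYPE NODE ON THE FROM CARRIER — `θ_v(p_c(G,v)) = 0` AT EVERY VERTEX**: every locally finite graph carrying a `PlanarSkeletonFrmFrom`
(unit steps, 1-Lipschitz chart, any number of types, cylinders connected from some width on) whose types are PAIRWISE CHART-ALIGNED
(`∀ s s' ∈ Φ.types, ∃ α : G ≃g G, φ ∘ α = φ + (φ s − φ s')`) — the scaled node at `toFrmScaled` (`L = N = 1`).  The unit-range form the virtually-`ℤ²` Cayley
customers with a chart constant on the coset representatives meet with `α := 1`.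
builds on p205010 (kernel theorem, internal audit signed; external expert review pending). [cite: BenjaminiSchramm1996, Conj. 4; §2] [cite: KozmaNitzan2024, §4] -/
theorem frmFromAligned_criticalContinuity_holds {V : Type} (G : SimpleGraph V) [G.LocallyFinite] (Φ : PlanarSkeletonFrmFrom G)
    (hal : ∀ s ∈ Φ.types, ∀ s' ∈ Φ.types, ∃ α : G ≃g G, ∀ w, Φ.φ (α w) = Φ.φ w + (Φ.φ s - Φ.φ s')) (v : V) :
    theta G v (criticalProbIOf G v) = 0 :=
  frmScaledAligned_criticalContinuity_holds G Φ.toFrmScaled le_rfl hal v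

/-- **… single-base form**: types aligned with ONE vertex `t` ⟹ `θ_t(p_c(G,t)) = 0` (From carrier).
builds on p205010 (kernel theorem, internal audit signed; external expert review pending). [cite: BenjaminiSchramm1996, Conj. 4] -/
theorem frmFromAligned_criticalContinuity_holds_at {V : Type} (G : SimpleGraph V) [G.LocallyFinite] (Φ : PlanarSkeletonFrmFrom G) (t : V)
    (hal : ∀ s ∈ Φ.types, ∃ α : G ≃g G, ∀ w, Φ.φ (α w) = Φ.φ w + (Φ.φ s - Φ.φ t)) : theta G t (criticalProbIOf G t) = 0 :=
  frmScaledAligned_criticalContinuity_holds_at G Φ.toFrmScaled le_rfl t hal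

end Transplant

end Summit.CriticalPhenomena.PercolationContinuityZ3.Theorems

end
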